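import Summits.ABC.ABC.Theses.PadicPrimesW80OddRadOne
import Summits.ABC.StewartYu.YuNinetyW80KappaTransfer
import Summits.ABC.StewartYu.KappaDoorEpsShape
import HarnessLib

set_option linter.dupNamespace false

/-!
# Route PadicPrimesW80OddRadOne (rung A1.M2⁻, `EpsShapeBoundOne`): the supports `FinFromW80Odd`
# (stmt-ABC-19443), `OddKappaDoorSpec` (stmt-ABC-19536) and the `Assembly` (stmt-ABC-19537)

`Summits/ABC/ABC/Theorems/PadicPrimesW80OddRadOneClosers.lean` — cell `abc-stewartyu`, seat p3 (g2).
All three are landed theorems: `FinFromW80Odd` is VERBATIM p3's `YuNinetyW80Kappa.oddTransferW80`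
(`YuNinetyW80KappaTransfer.lean`, p428600: the two Waldschmidt-shape residue-class texts give the κ-door
input `FinBoundAt p 8 (2·max(1,|c₅|,|c₅'|)) 1 2 1 2` at every odd prime); `OddKappaDoorSpec` is the cell's
odd κ-door `KappaDoor.epsShapeBound_of_oddFinBound`; the Assembly is the route's `closes`. [folklore].
WHAT THIS IS NOT: the two engine cruxes `W80ThreeModFour` (19485) / `W80OneModFour` (19487) are untouched.
-/

namespace Summit.ABC.ABC.Theorems

/-- **Item stmt-ABC-19443 `FinFromW80Odd`** — p3's `YuNinetyW80Kappa.oddTransferW80`. [folklore] -/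
theorem padicPrimesW80OddRadOne_finFromW80Odd_proof :
    Summit.ABC.ABC.Theses.PadicPrimesW80OddRadOne.FinFromW80Odd :=
  Summit.ABC.StewartYu.YuNinetyW80Kappa.oddTransferW80

/-- **Item stmt-ABC-19536 `OddKappaDoorSpec`** — the odd κ-door (any `κ ≥ 0`, `σ ≤ 2`, `τ, τ₁`).
[folklore] -/
theorem padicPrimesW80OddRadOne_oddKappaDoorSpec_proof :
    Summit.ABC.ABC.Theses.PadicPrimesW80OddRadOne.OddKappaDoorSpec := by
  unfold Summit.ABC.ABC.Theses.PadicPrimesW80OddRadOne.OddKappaDoorSpec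
  intro K L κ σ τ τ₁ hK hL _hκ0 hσ0 hσ h
  exact Summit.ABC.StewartYu.KappaDoor.epsShapeBound_of_oddFinBound hK hL hσ0 hσ
    (fun p hp hp2 => h p hp hp2)

/-- **Item stmt-ABC-19537 `Assembly`** of route `PadicPrimesW80OddRadOne`: the route's own `closes`.
[folklore] -/
theorem padicPrimesW80OddRadOne_assembly_proof :
    Summit.ABC.ABC.Theses.PadicPrimesW80OddRadOne.Assembly :=
  fun h₃ h₁ hF hO => Summit.ABC.ABC.Theses.PadicPrimesW80OddRadOne.closes h₃ h₁ hF hO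

end Summit.ABC.ABC.Theorems
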